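import Summits.FinalStateConjecture.FinalStateConjecture.Theses.EIHFluxBalance
import Literature.Geometry.Lorentzian.TameGenericityLocal
import Literature.Geometry.Lorentzian.TameGenericityDiagonal
import Literature.Geometry.Lorentzian.AFEndRestrict

/-!
# Sketch — crux idea `trim-on-the-cure` for `EIHFluxBalance.ModulatedKerrHandoff`
(item stmt-FinalStateConjecture-17402, H′ = the TAME re-type), crux-ideate round 1, ideator 1.

First lemmas of the line (all over existing declarations):

* `not_isImmersedAtZero_of_forall_eventuallyEq` (PROVED) — NO-GO 1: a one-parameter family
  which at every point of `X` eventually (as `c → 0`) agrees with its base member is not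
  immersed at `0`. Pure far-field surgeries (tail trimming at radius `R(c) → ∞`, burial,
  receding pulses) are of this kind, so under `IsTameChristodoulouGeneric` they are never
  witnesses by themselves.
* `IsImmersedAtZero.congr_of_forall_eventuallyEq` (PROVED) — conversely a far-field surgery at
  a radius `R(c) → ∞` riding ON an immersed family keeps it immersed (the diagonal family).
* `HandoffPropT`, `modulatedKerrHandoff_iff_tame` (`Iff.rfl`) — read-back of the re-typed crux.
* `modulatedKerrHandoff_of_relative` (PROVED) — THE DOOR: for ANY property `Q` of admissible
  data, tame genericity of `Q` plus a transformer turning tame `Q`-good curves into tame immersed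
  injective `HandoffPropT`-good curves through the same base datum proves the crux BY NAME
  (instance of the in-tree `isTameChristodoulouGeneric_of_relative'`).
* `QHyp`, `finalStateConjecture_of_qHyp_generic` (PROVED), `modulatedKerrHandoff_of_qHyp` (PROVED) — the
  honest typing of the import (the re-typed Statement's property + pairwise distinct label
  4-velocities), the check that its tame genericity is at least the summit, and the door
  specialised to it: `ModulatedKerrHandoff` from `TameGeneric QHyp` + the trim transformer.
* `IsTrimmed`, `TameTrimming` (statement, `Prop`) — the gluing-analytic input of the transformer:
  tame, jointly smooth Kerr/harmonic-asymptotics trimming of an admissible datum beyond radius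
  `R`, for all large `R`.
* `TameUnderFarSurgery` (statement, `Prop`) — tameness passes to a family that differs from a
  tame one only by far surgeries of vanishing weighted size.
-/

set_option linter.dupNamespace false
set_option linter.unusedVariables false

noncomputable section

namespace Summit.FinalStateConjecture.FinalStateConjecture.Cruxes.ModulatedKerrHandoff.TrimOnTheCure

open scoped BigOperators Topology Manifold Classical MeasureTheory Matrix InnerProductSpace ContDiff ENNReal
open Filter Set Function TopologicalSpace MeasureTheory Literature.Geometry.Lorentzian InitialDataSet
open Summit.FinalStateConjecture.FinalStateConjecture.Theses.EIHFluxBalance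

section NoGo

variable {X : Type*} [TopologicalSpace X] [ChartedSpace E3 X] [IsManifold (𝓡 3) ∞ X]

/-- **NO-GO 1 (pure far surgery is never a tame witness).** If a one-parameter family of initial
data agrees, at every point `x` of `X`, with its base member for all parameters `c` near `0`
(how near may depend on `x` — e.g. the family modifies `F 0` only beyond coordinate radius
`R(c) → ∞`), then every `c`-derivative of its sections at `c = 0` vanishes, so the family is not
immersed at `0` in the sense of `InitialDataSet.IsImmersedAtZero`. [folklore] -/
theorem not_isImmersedAtZero_of_forall_eventuallyEq
    (F : EuclideanSpace ℝ (Fin 1) → InitialDataSet (𝓡 3) X)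
    (hF : ∀ x : X, ∀ᶠ c in 𝓝 (0 : EuclideanSpace ℝ (Fin 1)),
      (F c).h.inner x = (F 0).h.inner x ∧ (F c).k x = (F 0).k x) :
    ¬ IsImmersedAtZero 1 F := by
  intro himm
  obtain ⟨x, u, w, huw⟩ := himm (EuclideanSpace.single (0 : Fin 1) (1 : ℝ)) (by simp)
  have h₁ : (fun c ↦ (F c).h.inner x u w) =ᶠ[𝓝 0] fun _ ↦ (F 0).h.inner x u w :=
    (hF x).mono fun c hc ↦ by simp only [hc.1]
  have h₂ : (fun c ↦ (F c).k x u w) =ᶠ[𝓝 0] fun _ ↦ (F 0).k x u w :=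
    (hF x).mono fun c hc ↦ by simp only [hc.2]
  rcases huw with h | h
  · exact h (by rw [h₁.fderiv_eq]; simp)
  · exact h (by rw [h₂.fderiv_eq]; simp)

/-- **Far surgery riding an immersed family keeps it immersed** (the diagonal family): if `F'`
agrees with `F` at every point for all parameters near `0` (e.g. `F' c` = `F c` trimmed beyond
radius `R(c) → ∞`), then immersion at `0` passes from `F` to `F'`. [folklore] -/
theorem _root_.Literature.Geometry.Lorentzian.InitialDataSet.IsImmersedAtZero.congr_of_forall_eventuallyEq
    {m : ℕ} {F F' : EuclideanSpace ℝ (Fin m) → InitialDataSet (𝓡 3) X}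
    (himm : IsImmersedAtZero m F)
    (hFF' : ∀ x : X, ∀ᶠ c in 𝓝 (0 : EuclideanSpace ℝ (Fin m)),
      (F' c).h.inner x = (F c).h.inner x ∧ (F' c).k x = (F c).k x) :
    IsImmersedAtZero m F' := by
  intro v hv
  obtain ⟨x, u, w, huw⟩ := himm v hv
  refine ⟨x, u, w, ?_⟩
  have h₁ : (fun c ↦ (F' c).h.inner x u w) =ᶠ[𝓝 0] fun c ↦ (F c).h.inner x u w :=
    (hFF' x).mono fun c hc ↦ by simp only [hc.1]
  have h₂ : (fun c ↦ (F' c).k x u w) =ᶠ[𝓝 0] fun c ↦ (F c).k x u w :=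
    (hFF' x).mono fun c hc ↦ by simp only [hc.2]
  rw [h₁.fderiv_eq, h₂.fderiv_eq]
  exact huw

omit [IsManifold (𝓡 3) ∞ X] in
/-- A far surgery at radius `R(c)` with `R(c) → ∞` as `c → 0` (punctured) and no surgery at
`c = 0` IS an eventual pointwise agreement in the sense of the two lemmas above: every point of
`X` lies outside `e.far (R c)` for `c` near `0`. [folklore] -/
theorem forall_eventually_not_mem_far (e : AFEnd X) {m : ℕ} {R : EuclideanSpace ℝ (Fin m) → ℝ}
    (hR : Tendsto R (𝓝[≠] 0) atTop) (x : X) :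
    ∀ᶠ c in 𝓝[≠] (0 : EuclideanSpace ℝ (Fin m)), x ∉ e.far (R c) := by
  by_cases hx : x ∈ (e.U : Set X)
  · have hev : ∀ᶠ c in 𝓝[≠] (0 : EuclideanSpace ℝ (Fin m)), ‖(e.chart ⟨x, hx⟩ : E3)‖ < R c :=
      hR.eventually (eventually_gt_atTop _)
    refine hev.mono fun c hc hmem ↦ ?_
    obtain ⟨y, hy, hyx⟩ := hmem
    have : y = ⟨x, hx⟩ := Subtype.ext hyx
    subst this
    exact lt_irrefl _ (lt_trans hy hc)
  · exact Eventually.of_forall fun c hmem ↦ hx (e.far_subset _ hmem)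

end NoGo

section Door

/-- The property of an admissible datum whose TAME Christodoulou-genericity the re-typed crux
asserts (verbatim the `fun D ↦ …` of `EIHFluxBalance.ModulatedKerrHandoff`, item 17402): an MGHD
exists, and every MGHD has complete `𝓘⁺` and is asymptotic to a modulated multi-Kerr–Schild
ansatz with the four handoff clauses (T), (O), (R), (QS). -/
def HandoffPropT (X : Type) [TopologicalSpace X] [ChartedSpace E3 X]
    [IsManifold (𝓡 3) ((⊤ : ℕ∞) : WithTop ℕ∞) X] [T2Space X] [SecondCountableTopology X]
    [ConnectedSpace X] (D : InitialDataSet (𝓡 3) X) : Prop :=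
  (∃ 𝒟 : VacuumCauchyDevelopment D, 𝒟.IsMaximal) ∧ ∀ 𝒟 : VacuumCauchyDevelopment D, 𝒟.IsMaximal → Summit.FinalStateConjecture.HasCompleteNullInfinity 𝒟.toCauchyDevelopment ∧ (∃ (N : ℕ) (M a rin : Fin N → ℝ) (Λ : Fin N → ℝ → lorentzGroup) (ξ : Fin N → ℝ → E3) (γ κ τ₀ : ℝ) (U : Opens E4) (Φ : U → 𝒟.carrier) (O : Set 𝒟.carrier), (∀ i, Kerr.IsSubextremal (M i) (a i) ∧ Kerr.rMinus (M i) (a i) < rin i ∧ rin i < Kerr.rPlus (M i) (a i)) ∧ (∀ i t, |((Λ i t : E4 ≃L[ℝ] E4) (E4.basisVector 0)) 0| ≤ γ) ∧ (∀ i, ContDiff ℝ ((⊤ : ℕ∞) : WithTop ℕ∞) (ξ i) ∧ ContDiff ℝ ((⊤ : ℕ∞) : WithTop ℕ∞) (fun t ↦ ((Λ i t : E4 ≃L[ℝ] E4) : E4 →L[ℝ] E4))) ∧ (∀ i j, i ≠ j → Tendsto (fun t ↦ ‖ξ i t - ξ j t‖) atTop atTop) ∧ (0 < κ ∧ κ <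 1 ∧ ∀ i, ∀ᶠ t in atTop, ‖ξ i t‖ ≤ κ ^ 2 * t) ∧ ({x : E4 | τ₀ < x 0 ∧ ∀ i, rin i < Kerr.radius (a i) (poincareInv (Λ i (x 0)) (E4.ofTimeSpace (x 0) (ξ i (x 0))) x)} ⊆ (U : Set E4)) ∧ let B : ModelBackground := ⟨U, fun x ↦ Minkowski.bilin + ∑ i, (boostedKerrBilin (Λ i (x 0)) (E4.ofTimeSpace (x 0) (ξ i (x 0))) (M i) (a i) x - Minkowski.bilin), fun x ↦ x 0, E4.spatialNorm⟩; ContMDiff 𝓘(ℝ, E4) (𝓡 4) ((⊤ : ℕ∞) : WithTop ℕ∞) Φ ∧ Topology.IsOpenEmbedding ((B.lateRegion τ₀).restrict Φ) ∧ Φ '' {x : U | τ₀ < x.1 0 ∧ ∀ i, Kerr.rPlus (M i) (a i) < Kerr.radius (a i) (poincareInv (Λ i (x.1 0)) (E4.ofTimeSpace (x.1 0) (ξ i (x.1 0))) x.1)} ⊆ O ∧ Tendsto (fun t ↦ 𝒟.toSpacetime.deviationCk B Φ 3 t) atTop (𝓝 0) ∧ Tendsto (fun t : ℝ ↦ ⨆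 x ∈ {x : U | x.1 0 = t ∧ E4.spatialNorm x.1 ≤ κ * t}, ⨆ (m : ℕ) (_ : m ≤ 3), ENNReal.ofReal (1 + √(√((⨅ i, ‖E4.spatial x.1 - ξ i t‖) ^ 7))) * ‖iteratedFDeriv ℝ m (𝒟.toSpacetime.deviationExtend B Φ) x.1‖ₑ) atTop (𝓝 0) ∧ O = Summit.FinalStateConjecture.exteriorOf 𝒟.toCauchyDevelopment (Φ '' {x : U | τ₀ < x.1 0 ∧ ∀ i, Kerr.rPlus (M i) (a i) < Kerr.radius (a i) (poincareInv (Λ i (x.1 0)) (E4.ofTimeSpace (x.1 0) (ξ i (x.1 0))) x.1)}) ∧ (∀ t₁ : ℝ, τ₀ < t₁ → O \ Φ '' {x : U | t₁ < x.1 0 ∧ ∀ i, Kerr.rPlus (M i) (a i) < Kerr.radius (a i) (poincareInv (Λ i (x.1 0)) (E4.ofTimeSpace (x.1 0) (ξ i (x.1 0))) x.1)} ⊆ 𝒟.metric.causalPast 𝒟.timeOrientation (Φ '' {x : U | x.1 0 = t₁ ∧ ∀ i, Kerr.rPlus (M i) (a i) < Kerr.radius (a i) (poincareInv (Λ i (x.1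 0)) (E4.ofTimeSpace (x.1 0) (ξ i (x.1 0))) x.1)})) ∧ (∃ τ₁ : ℝ, ∀ x y : U, (τ₁ < x.1 0 ∧ ∀ i, rin i < Kerr.radius (a i) (poincareInv (Λ i (x.1 0)) (E4.ofTimeSpace (x.1 0) (ξ i (x.1 0))) x.1)) → (τ₁ < y.1 0 ∧ ∀ i, rin i < Kerr.radius (a i) (poincareInv (Λ i (y.1 0)) (E4.ofTimeSpace (y.1 0) (ξ i (y.1 0))) y.1)) → Φ y ∈ 𝒟.metric.causalFuture 𝒟.timeOrientation {Φ x} → x.1 0 ≤ y.1 0) ∧ (∀ (i : Fin N) (t : ℝ), 0 < (((Λ i t : lorentzGroup) : E4 ≃L[ℝ] E4) (E4.basisVector 0)) 0) ∧ Summit.FinalStateConjecture.RaysStayInClosure 𝒟.toCauchyDevelopment O ∧ (∀ ρ : ℝ → ℝ, Tendsto ρ atTop atTop → Tendsto (fun t : ℝ ↦ ⨆ x ∈ {x : E4 | x 0 = t ∧ E4.spatialNorm x ≤ κ * t ∧ ρ t ≤ ⨅ i, ‖E4.spatial x - ξ i t‖}, ENNReal.ofReal (1 + √(√((⨅ i,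 ‖E4.spatial x - ξ i t‖) ^ 7))) * ‖fderiv ℝ (fun y : E4 ↦ Minkowski.bilin + ∑ i, (boostedKerrBilin (Λ i (y 0)) (E4.ofTimeSpace (y 0) (ξ i (y 0))) (M i) (a i) y - Minkowski.bilin)) x (E4.basisVector 0)‖ₑ) atTop (𝓝 0)))

/-- FAITHFULNESS of the read-back: the crux is literally tame genericity of `HandoffPropT`,
`Σ` by `Σ`. -/
theorem modulatedKerrHandoff_iff_tame :
    ModulatedKerrHandoff ↔
      ∀ (X : Type) [TopologicalSpace X] [ChartedSpace E3 X]
        [IsManifold (𝓡 3) ((⊤ : ℕ∞) : WithTop ℕ∞) X] [T2Space X] [SecondCountableTopology X]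
        [ConnectedSpace X],
        IsTameChristodoulouGeneric (admissibleVacuumData X) (HandoffPropT X) 1 :=
  Iff.rfl

/-- **THE DOOR (proved): the crux from ANY tame-generic property `Q` plus a curve transformer.**
If `Q` is tame-Christodoulou-generic in the admissible class (e.g. the summit Statement's own
settled property with distinct asymptotic velocities, supplied by a genericity route), and every
tame curve of admissible data whose members off `0` satisfy `Q` (immersed-injective, or constant)
can be transformed into a tame immersed injective curve of admissible data through the SAME base
datum whose members off `0` satisfy `HandoffPropT` — the intended transformer being
"trim the tail of `F c` to a Kerr / harmonic-asymptotics end beyond a free radius `R(c) → ∞`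
(and breathe by a gauge pullback in the constant case)" — then `ModulatedKerrHandoff` holds.
Instance of `isTameChristodoulouGeneric_of_relative'` (TameGenericityDiagonal.lean); the sole
strongly-flat end of an admissible datum makes constant curves tame. -/
theorem modulatedKerrHandoff_of_relative
    (Q : ∀ (X : Type) [TopologicalSpace X] [ChartedSpace E3 X]
      [IsManifold (𝓡 3) ((⊤ : ℕ∞) : WithTop ℕ∞) X] [T2Space X] [SecondCountableTopology X]
      [ConnectedSpace X], InitialDataSet (𝓡 3) X → Prop)
    (hQ : ∀ (X : Type) [TopologicalSpace X] [ChartedSpace E3 X]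
      [IsManifold (𝓡 3) ((⊤ : ℕ∞) : WithTop ℕ∞) X] [T2Space X] [SecondCountableTopology X]
      [ConnectedSpace X], IsTameChristodoulouGeneric (admissibleVacuumData X) (Q X) 1)
    (hrel : ∀ (X : Type) [TopologicalSpace X] [ChartedSpace E3 X]
      [IsManifold (𝓡 3) ((⊤ : ℕ∞) : WithTop ℕ∞) X] [T2Space X] [SecondCountableTopology X]
      [ConnectedSpace X], ∀ (e : AFEnd X) (F : EuclideanSpace ℝ (Fin 1) → InitialDataSet (𝓡 3) X),
      IsTameDataFamily e 1 F → ((IsImmersedAtZero 1 F ∧ Injective F) ∨ ∀ c, F c = F 0) →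
        (∀ c, F c ∈ admissibleVacuumData X) → (∀ c ≠ 0, Q X (F c)) →
          ∃ (e' : AFEnd X) (F' : EuclideanSpace ℝ (Fin 1) → InitialDataSet (𝓡 3) X),
            IsTameDataFamily e' 1 F' ∧ F' 0 = F 0 ∧ Injective F' ∧ IsImmersedAtZero 1 F' ∧
              (∀ c, F' c ∈ admissibleVacuumData X) ∧ ∀ c ≠ 0, HandoffPropT X (F' c)) :
    ModulatedKerrHandoff := by
  intro X _ _ _ _ _ _
  refine isTameChristodoulouGeneric_of_relative' (fun d hd ↦ ?_) (hQ X) (hrel X)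
  obtain ⟨-, e, M, hsole, hSAF⟩ := hd
  exact ⟨e, hsole, M, hSAF⟩

end Door

section QHyp

/-- **The import, typed honestly in the Statement's own vocabulary.** `QHyp X D` := the re-typed
summit property of the datum `D` (MGHD exists; every MGHD has complete `𝓘⁺` and a sub-extremal,
exhaustive, ray-closed, future-oriented `C²` final-state decomposition — verbatim the `fun D ↦ …`
of `FinalStateConjecture`) WITH ONE EXTRA CLAUSE: the asymptotic motions have pairwise distinct
4-velocities `Λᵢ e₀ ≠ Λⱼ e₀` (hyperbolic recession of every pair; honest because
`HasExhaustiveCharts` forbids empty excised tubes, so a parabolically separating pair is forced to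
carry equal labels). This is the crux's only genericity debt beyond the Statement (card
trim-on-the-cure, Why-it-bites 3). -/
def QHyp (X : Type) [TopologicalSpace X] [ChartedSpace E3 X]
    [IsManifold (𝓡 3) ((⊤ : ℕ∞) : WithTop ℕ∞) X] [T2Space X] [SecondCountableTopology X]
    [ConnectedSpace X] (D : InitialDataSet (𝓡 3) X) : Prop :=
  (∃ 𝒟 : VacuumCauchyDevelopment D, 𝒟.IsMaximal) ∧
    ∀ 𝒟 : VacuumCauchyDevelopment D, 𝒟.IsMaximal →
      Summit.FinalStateConjecture.HasCompleteNullInfinity 𝒟.toCauchyDevelopment ∧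
        ∃ (O : Set 𝒟.carrier) (d : FinalStateDecomposition 𝒟.toSpacetime O 2),
          (∀ i, Kerr.IsSubextremal (d.mass i) (d.spin i)) ∧
            O = Summit.FinalStateConjecture.exteriorOf 𝒟.toCauchyDevelopment d.charted ∧
              Summit.FinalStateConjecture.RaysStayInClosure 𝒟.toCauchyDevelopment O ∧
                Summit.FinalStateConjecture.HasExhaustiveCharts d ∧
                  Summit.FinalStateConjecture.IsFutureOriented d ∧
                    ∀ i j, i ≠ j →
                      ((d.motion i).1 : E4 ≃L[ℝ] E4) (E4.basisVector 0) ≠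
                        ((d.motion j).1 : E4 ≃L[ℝ] E4) (E4.basisVector 0)

/-- HONESTY CHECK (proved): tame genericity of `QHyp` is at least the summit — the import the
door consumes is FSC-strength (plus one wall), as the card concedes. -/
theorem finalStateConjecture_of_qHyp_generic
    (hQ : ∀ (X : Type) [TopologicalSpace X] [ChartedSpace E3 X]
      [IsManifold (𝓡 3) ((⊤ : ℕ∞) : WithTop ℕ∞) X] [T2Space X] [SecondCountableTopology X]
      [ConnectedSpace X], IsTameChristodoulouGeneric (admissibleVacuumData X) (QHyp X) 1) :
    _root_.FinalStateConjecture := by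
  intro X _ _ _ _ _ _
  refine (hQ X).mono fun D _ hD ↦ ⟨hD.1, fun 𝒟 h𝒟 ↦ ⟨(hD.2 𝒟 h𝒟).1, ?_⟩⟩
  obtain ⟨O, d, hsub, hO, hR, hE, hF, -⟩ := (hD.2 𝒟 h𝒟).2
  exact ⟨O, d, hsub, hO, hR, hE, hF⟩

/-- **THE LINE'S TOP-LEVEL SHAPE (proved): `ModulatedKerrHandoff` from tame genericity of `QHyp`
and the TRIM TRANSFORMER** — the `hrel` of the door with `Q := QHyp`: every tame curve of
admissible data on an end `e` whose members off `0` are `QHyp`-good (immersed-injective, or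
constant) transforms into a tame immersed injective curve of admissible data through the same base
datum whose members off `0` satisfy `HandoffPropT` (intended: `F' c = T_{R(c)} (F c)`, resp.
`T_{R(c)} (breathe_c (F 0))`, with `R(c) → ∞` free; stubs TameTrimming, TameUnderFarSurgery,
eventual trim-stability of `QHyp`-good data, format synthesis on the Kerr-ended class). -/
theorem modulatedKerrHandoff_of_qHyp
    (hQ : ∀ (X : Type) [TopologicalSpace X] [ChartedSpace E3 X]
      [IsManifold (𝓡 3) ((⊤ : ℕ∞) : WithTop ℕ∞) X] [T2Space X] [SecondCountableTopology X]
      [ConnectedSpace X], IsTameChristodoulouGeneric (admissibleVacuumData X) (QHyp X) 1)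
    (hTrim : ∀ (X : Type) [TopologicalSpace X] [ChartedSpace E3 X]
      [IsManifold (𝓡 3) ((⊤ : ℕ∞) : WithTop ℕ∞) X] [T2Space X] [SecondCountableTopology X]
      [ConnectedSpace X], ∀ (e : AFEnd X) (F : EuclideanSpace ℝ (Fin 1) → InitialDataSet (𝓡 3) X),
      IsTameDataFamily e 1 F → ((IsImmersedAtZero 1 F ∧ Injective F) ∨ ∀ c, F c = F 0) →
        (∀ c, F c ∈ admissibleVacuumData X) → (∀ c ≠ 0, QHyp X (F c)) →
          ∃ (e' : AFEnd X) (F' : EuclideanSpace ℝ (Fin 1) → InitialDataSet (𝓡 3) X),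
            IsTameDataFamily e' 1 F' ∧ F' 0 = F 0 ∧ Injective F' ∧ IsImmersedAtZero 1 F' ∧
              (∀ c, F' c ∈ admissibleVacuumData X) ∧ ∀ c ≠ 0, HandoffPropT X (F' c)) :
    ModulatedKerrHandoff :=
  modulatedKerrHandoff_of_relative QHyp hQ hTrim

end QHyp

section Trimming

variable {X : Type*} [TopologicalSpace X] [ChartedSpace E3 X] [IsManifold (𝓡 3) ∞ X]

/-- A datum is **trimmed on the end `e`** if, in the chart of `e`, it is Schwarzschildean to
the orders the crux's far-field clauses need: `h − (1 + 2M/r)δ = o₄(r^{-15/8})`,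
`k = o₃(r^{-23/8})` (`IsStronglyAsymptoticallyFlatWith e D M (15/8) (23/8) 4 3`). Exact Kerr
`t_BL`-slice ends (Corvino–Schoen 2006, Thm 2) and harmonic-asymptotics ends `h = u⁴δ`,
`π = u²𝓛_Yδ`, `Δu = 0` (Corvino–Schoen 2006, Thm 1) are trimmed: their remainders are
`O_∞(r⁻²)` resp. `O_∞(r⁻³)`. The exponents sit strictly inside the crux's window: a data tail
`o(r^{-7/4})` is what the `m = 0` cone weight `d^{7/4}` tolerates (obstructions.md B2), and four
derivatives answer the `C³` slab clause (TRIAGE-r1-1, R2). -/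
def IsTrimmed (e : AFEnd X) (D : InitialDataSet (𝓡 3) X) : Prop :=
  ∃ M : ℝ, e.IsStronglyAsymptoticallyFlatWith D M (15 / 8) (23 / 8) 4 3

/-- **TAME TRIMMING (statement; the gluing-analytic stub of the line).** Through every admissible
datum `d`, read on its sole strongly-flat end `e`, passes a family `R ↦ T R` (`R ≥ R₀`) of
admissible data with: `T R = d` off the far region `e.far R` (sections agree pointwise);
`T R` trimmed on `e`; joint smoothness along every smooth radius schedule; and TAMENESS —
Dafermos–Rodnianski decay on the SAME end with a mass `M(R)` continuous in `R`, and
`e.wDist (T R) d → 0` as `R → ∞`. Engines: Corvino–Schoen density of harmonic asymptotics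
(doi:10.4310/jdg/1146169910, Thm 1) / exterior Kerr gluing (ibid. Thm 2; Chruściel–Delay
doi:10.24033/msmf.407), made parametric in `R` through solution operators with prescribed
support (Mao–Oh–Tao arXiv:2308.13031) or an implicit-function formulation; the weighted
smallness IS the `R → ∞` limit of their correction estimates. In-tree plumbing: `AFEnd.patch`,
`AFEnd.annulusPatch`, `IsStronglyAsymptoticallyFlatDR.congr_of_eqOn_far`. -/
def TameTrimming : Prop :=
  ∀ (X : Type) [TopologicalSpace X] [ChartedSpace E3 X] [IsManifold (𝓡 3) ∞ X] [T2Space X]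
    [SecondCountableTopology X] [ConnectedSpace X],
    ∀ (e : AFEnd X) (d : InitialDataSet (𝓡 3) X) (M₀ : ℝ), d ∈ admissibleVacuumData X →
      e.IsSoleEnd → e.IsStronglyAsymptoticallyFlatDR d M₀ →
        ∃ (R₀ : ℝ) (T : ℝ → InitialDataSet (𝓡 3) X) (M : ℝ → ℝ),
          (∀ R, R₀ ≤ R →
            T R ∈ admissibleVacuumData X ∧ IsTrimmed e (T R) ∧
              e.IsStronglyAsymptoticallyFlatDR (T R) (M R) ∧
                ∀ x ∉ e.far R, (T R).h.inner x = d.h.inner x ∧ (T R).k x = d.k x) ∧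
          (∀ ρ : EuclideanSpace ℝ (Fin 1) → ℝ, ContDiff ℝ ∞ ρ → (∀ c, R₀ ≤ ρ c) →
            IsSmoothDataFamily 1 (fun c ↦ T (ρ c))) ∧
          ContinuousOn M (Ici R₀) ∧ Tendsto M atTop (𝓝 M₀) ∧
          Tendsto (fun R ↦ e.wDist (T R) d) atTop (𝓝 0)

/-- **TAMENESS UNDER FAR SURGERY (statement; the algebraic stub).** If `F` is tame on `e`, and
`F'` is a jointly smooth family with the same base member whose members are Dafermos–Rodnianski
flat on `e` with a continuous mass and whose weighted distance to the corresponding members of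
`F` tends to `0` at the base parameter, then `F'` is tame on `e`. (Triangle inequality for
`AFEnd.wDist` plus bookkeeping; with `IsImmersedAtZero.congr_of_forall_eventuallyEq` this makes
the DIAGONAL family `c ↦ T_{R(c)}(F c)` a tame immersed family for every schedule `R(c) → ∞`.)
[folklore] -/
def TameUnderFarSurgery : Prop :=
  ∀ (X : Type) [TopologicalSpace X] [ChartedSpace E3 X] [IsManifold (𝓡 3) ∞ X]
    (e : AFEnd X) (m : ℕ) (F F' : EuclideanSpace ℝ (Fin m) → InitialDataSet (𝓡 3) X)
    (M' : EuclideanSpace ℝ (Fin m) → ℝ),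
    IsTameDataFamily e m F → IsSmoothDataFamily m F' → F' 0 = F 0 →
      Continuous M' → (∀ c, e.IsStronglyAsymptoticallyFlatDR (F' c) (M' c)) →
        Tendsto (fun c ↦ e.wDist (F' c) (F c)) (𝓝 0) (𝓝 0) →
          IsTameDataFamily e m F'

end Trimming

end Summit.FinalStateConjecture.FinalStateConjecture.Cruxes.ModulatedKerrHandoff.TrimOnTheCure

end
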